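import Summits.BirchSwinnertonDyer.Rank1Residual.Additive.GordBranchMeetsField
import Summits.BirchSwinnertonDyer.Rank1Residual.Additive.SubGordThree
import Summits.BirchSwinnertonDyer.Rank1Residual.Additive.SubGordTwoReducible
import Summits.BirchSwinnertonDyer.Rank1Residual.Additive.CyclotomicQuadraticSubfield
import Literature.NumberTheory.EllipticCurves.KellerYin2024.PotentiallyGoodOrdinaryIwasawaTheory
import HarnessLib

/-!
# Route `SchneiderFreeAdditiveX3` (K1 door), crux `GordTwoBranchIMC` (stmt-BirchSwinnertonDyer-19177):
# the (G-ord, `e = 2`) cell is Keller–Yin's Case (I) — `PotOrdSetting.caseOne` DISCHARGED on the cell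

Cell `bsd-schneider-ideate`, seat `bsd-schneider-door-c3` (prover, generation 7). HONEST FRAMING: a
fact-free structural lemma for the KY-READING of crux r3 (planner memo `KY24b-anatomy-P2-g12.md`,
gap **F-caseOne** / statement **K-c**): on X3 ∩ (G-ord, `e = 2`) at an odd prime `p` the curve
ACQUIRES GOOD ORDINARY REDUCTION OVER A QUADRATIC FIELD, i.e. the tree predicate
`WeierstrassCurve.HasGoodOrdinaryReductionOverQuadraticAt` — the binder `caseOne` of the littype
transcription `KellerYin2024.PotOrdSetting` of Keller–Yin arXiv:2410.23241 §3 ("Case (I), i.e.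
`p ∤ N′`"). Proof: present the pair through its good-ordinary partner, a globally minimal model `W₁` of
`W ⊗ χ_{p*}` with `GoodOrd W₁ p` (`TypeGOrd.exists_goodOrd_model_twist_pStar`, every odd `p`, the
cell's (G)-ordinary theory class), take `F = ℚ(√p*) ⊆ ℚ(ζ_p)` (`[F : ℚ] = 2`, quadratic Gauss sum)
and a place `w ∣ p` of `F`; `W₁,F` is good with the unit-root condition at `w` (ascent from `ℚ`), and
`W_F ≅ W₁,F`
(`p*` is a square in `F`), both properties being isomorphism invariants. Nothing is asserted about
BSD or about the crux (OPEN, F2-class behind a preprint); `--supports` material for item 19177.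

References: Keller–Yin arXiv:2410.23241 §3.1 Case (I) (p. 13); Silverman, *AEC* VII.5.4, X.5.4;
Ireland–Rosen Prop. 6.3.2; Greenberg LNM 1716 Thm. 1.2 (unit-root hypothesis).
-/

noncomputable section

open scoped Classical NumberField

open WeierstrassCurve IsDedekindDomain IsDedekindDomain.HeightOneSpectrum NumberField
  Rat.HeightOneSpectrum Literature.NumberTheory.EllipticCurves
  Literature.NumberTheory.EllipticCurves.Rank1Residual
  Summit.BirchSwinnertonDyer.Rank1Residual

-- D-0017 layout: summit = sub-problem, so `Summit.BirchSwinnertonDyer.BirchSwinnertonDyer.…` is the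
-- mandated namespace (same option as the route's sockets files).
set_option linter.dupNamespace false
set_option autoImplicit false

namespace Summit.BirchSwinnertonDyer.BirchSwinnertonDyer.Theorems.SchneiderFree

/-! ## §1 A curve whose twist by `p*` is good ordinary has good ordinary reduction over `ℚ(√p*)` -/

/-- **Good ordinary twist by `p*` ⇒ Case (I).** Let `p` be odd, `W/ℚ` elliptic, and `W₁/ℚ` a
globally minimal model of the quadratic twist `W ⊗ χ_{p*}` (`C • (W ⊗ p*) = W₁`,
`p* = (−1)^{⌊p/2⌋} p`) with GOOD ORDINARY reduction at `p` (`GoodOrd W₁ p`). Then `W` has good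
ordinary reduction over the quadratic field `F = ℚ(√p*) ⊆ ℚ(ζ_p)` (`[F : ℚ] = 2`, quadratic Gauss
sum): at a place `w ∣ p` of `F`, `W₁,F` is good (Silverman VII.5.4) with the unit-root condition
(`a_w ≡ a_p^f (mod p)`), and `W₁,F ≅ W_F` since `p*` is a square in `F` (Silverman X.5.4); good
reduction and the unit-root condition are isomorphism invariants.
[cite: SilvermanAEC2009, VII.5 Prop. 5.4 and X.5 Cor. 5.4]
[cite: KellerYin2024b, §3.1 Case (I) (arXiv:2410.23241 p. 13)] -/
theorem hasGoodOrdinaryReductionOverQuadraticAt_of_goodOrd_model_twist_pStar {p : ℕ}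
    [hp : Fact p.Prime] (hp2 : p ≠ 2) (W W₁ : WeierstrassCurve ℚ) [W.IsElliptic] [W₁.IsElliptic]
    [W₁.IsGloballyMinimal] (C : VariableChange ℚ)
    (hC : C • W.quadraticTwist ((-1 : ℚ) ^ (p / 2) * p) = W₁) (hord : GoodOrd W₁ p) :
    W.HasGoodOrdinaryReductionOverQuadraticAt p := by
  -- the quadratic field `F = ℚ(√p*)` inside the `p`-th cyclotomic field
  haveI hcycL : IsCyclotomicExtension {p} ℚ (CyclotomicField p ℚ) := by
    have h : (CyclotomicField.algebra p ℚ : Algebra ℚ (CyclotomicField p ℚ)) =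
        DivisionRing.toRatAlgebra := Subsingleton.elim _ _
    exact h ▸ CyclotomicField.isCyclotomicExtension p ℚ
  haveI : NumberField (CyclotomicField p ℚ) := IsCyclotomicExtension.numberField {p} ℚ _
  obtain ⟨g, hg, hF2⟩ :=
    Additive.exists_sq_eq_pStar_and_finrank_eq_two p (L := CyclotomicField p ℚ) hp2
  set F : IntermediateField ℚ (CyclotomicField p ℚ) := IntermediateField.adjoin ℚ {g} with hFdef
  haveI : NumberField F := NumberField.of_module_finite ℚ F
  -- a place `w ∣ p` of `F`, over the place `v` of `ℚ` at `p`
  obtain ⟨w, hw⟩ := Additive.exists_heightOneSpectrum_natCast_mem F p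
  set v : HeightOneSpectrum (𝓞 ℚ) := (primesEquiv (R := 𝓞 ℚ)).symm ⟨p, hp.out⟩ with hvdef
  have hpv : (p : 𝓞 ℚ) ∈ v.asIdeal :=
    (natCast_mem_asIdeal_iff_eq_primesEquiv_symm v hp.out).mpr rfl
  have hwv : w.asIdeal.under (𝓞 ℚ) = v.asIdeal := Additive.under_eq_asIdeal_of_natCast_mem p w hw
  haveI : w.asIdeal.LiesOver v.asIdeal := ⟨hwv.symm⟩
  -- `W₁` is good ordinary at `v`, hence `W₁,F` is good ordinary at `w`
  obtain ⟨hgood₁, hunit₁⟩ := W₁.hasGoodReductionAt_and_hasUnitRootAt_of_rat hord.1 hord.2 v hpv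
  have hgF : (W₁.baseChange F).HasGoodReductionAt w :=
    hasGoodReductionAt_baseChange_of_hasGoodReductionAt W₁ F v w hgood₁
  have huF : (W₁.baseChange F).HasUnitRootAt w :=
    Additive.hasUnitRootAt_baseChange_of_hasGoodReductionAt W₁ F p hpv hwv hgood₁ hunit₁
  -- `p*` is the square of `θ = g ∈ F`
  set d : ℚ := (-1 : ℚ) ^ (p / 2) * p with hd
  set θ : F := ⟨g, IntermediateField.mem_adjoin_simple_self ℚ g⟩ with hθdef
  have hθ2 : algebraMap ℚ F d = 1 * θ ^ 2 := by
    apply Subtype.ext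
    rw [one_mul, hθdef]
    change algebraMap ℚ (CyclotomicField p ℚ) d = g ^ 2
    rw [hg, hd, map_mul, map_pow, map_neg, map_one, map_natCast]
  have hθ0 : θ ≠ 0 := by
    intro h0
    have : algebraMap ℚ F d = 0 := by rw [hθ2, h0]; simp
    rw [map_eq_zero] at this
    exact (mul_ne_zero (pow_ne_zero _ (by norm_num)) (by exact_mod_cast hp.out.ne_zero)) this
  -- `W₁,F ≅ W_F`
  have htw : (W.quadraticTwist d).baseChange F = (W.baseChange F).quadraticTwist (1 * θ ^ 2) := by
    rw [← hθ2]
    exact map_quadraticTwist W (algebraMap ℚ F) d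
  haveI : NeZero (2 : F) := ⟨two_ne_zero⟩
  haveI : (W.baseChange F).IsElliptic := by rw [baseChange]; infer_instance
  obtain ⟨C₁, hC₁⟩ := exists_variableChange_quadraticTwist_one (W.baseChange F)
  obtain ⟨C₂, hC₂⟩ := exists_variableChange_quadraticTwist_mul_sq (W.baseChange F) 1 θ hθ0
  have hW₁F : W₁.baseChange F = (C.map (algebraMap ℚ F)) • (W.quadraticTwist d).baseChange F := by
    rw [← hC, baseChange, baseChange, ← map_variableChange]
  have hiso : (C.map (algebraMap ℚ F) * (C₂ * C₁)) • W.baseChange F = W₁.baseChange F := by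
    rw [mul_smul, mul_smul, hC₁, hC₂, ← htw, hW₁F]
  have hgW : (W.baseChange F).HasGoodReductionAt w := by
    rw [← hiso] at hgF
    exact (hasGoodReductionAt_smul_iff_holds w (W.baseChange F) _).mp hgF
  have huW : (W.baseChange F).HasUnitRootAt w := by
    rw [← hiso] at huF
    exact (Additive.hasUnitRootAt_smul_iff (W.baseChange F) _ w hgW).mp huF
  exact ⟨F, inferInstance, inferInstance, w, hF2.le, hw, hgW, huW⟩

/-! ## §2 The cell X3 ∩ (G-ord, `e = 2`) is Case (I) -/

/-- **K-c: `PotOrdSetting.caseOne` holds on the (G-ord, `e = 2`) cell** (Keller–Yin's Case (I)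
"`p ∤ N′`" for an elliptic curve: good ordinary reduction over a field of degree `≤ 2`). For `W`
globally minimal on X3 ∩ `SubGordTwo` at an odd `p`, `W ≅ W′ ⊗ χ_{p*}` with `W′` good ORDINARY at
`p` (the cell's (G)-ordinary theory class: `TypeGOrd.exists_goodOrd_model_twist_pStar`, at `p = 3`
via `classX3Gord_three_iff_subGord`, at `p ≥ 5` via `typeGOrd_of_classX3_of_subGord` — the same
case split as door-c3's `exists_goodOrd_partner_of_subGordTwo_odd`), and §1 applies. Fact-free. [cite: KellerYin2024b, §3.1 Case (I) (arXiv:2410.23241 p. 13)]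
[cite: Delbourgo1998, §1.5 (hypothesis (G), p. 130)] -/
theorem hasGoodOrdinaryReductionOverQuadraticAt_of_subGordTwo {p : ℕ} [hp : Fact p.Prime]
    (hp2 : p ≠ 2) (W : WeierstrassCurve ℚ) [W.IsElliptic] [W.IsGloballyMinimal]
    (hX : ClassX3 W p) (hS : Additive.SubGordTwo W p) :
    W.HasGoodOrdinaryReductionOverQuadraticAt p := by
  have hG : Additive.TypeGOrd W p := by
    by_cases hp3 : p = 3
    · subst hp3
      exact ((Additive.classX3Gord_three_iff_subGord W hX).mpr hS.1).typeGOrd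
    · have hp5 : 5 ≤ p := by
        rcases Nat.lt_or_ge p 5 with h | h
        · interval_cases p <;> first | omega | exact absurd hp.out (by decide)
        · exact h
      exact Additive.typeGOrd_of_classX3_of_subGord W p hp5 hX hS.1
  obtain ⟨W₁, hE₁, hmin₁, ⟨C, hC⟩, hord⟩ :=
    Additive.TypeGOrd.exists_goodOrd_model_twist_pStar W p hp2 hG hX.2 hS.2
  exact hasGoodOrdinaryReductionOverQuadraticAt_of_goodOrd_model_twist_pStar hp2 W W₁ C hC hord

/-- **The Case (I) hypothesis of Keller–Yin is implied by the cell predicate, in the shape the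
littype's OPEN facts consume** (`thm371_pConverse_caseOne_OPEN`, `PotOrdSetting.caseOne`): on X3 ∩
`SubGordTwo`, `p` odd, both `2 < p` and `HasGoodOrdinaryReductionOverQuadraticAt` hold, and
`Red W p` is the first conjunct of `ClassX3`. Bookkeeping. [cite: KellerYin2024b, §3.1 Case (I) and §3.3 ¶1 (arXiv:2410.23241 pp. 13, 17)] -/
theorem two_lt_and_caseOne_and_red_of_subGordTwo {p : ℕ} [hp : Fact p.Prime] (hp2 : p ≠ 2)
    (W : WeierstrassCurve ℚ) [W.IsElliptic] [W.IsGloballyMinimal] (hX : ClassX3 W p)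
    (hS : Additive.SubGordTwo W p) :
    2 < p ∧ W.HasGoodOrdinaryReductionOverQuadraticAt p ∧ Red W p :=
  ⟨lt_of_le_of_ne hp.out.two_le (Ne.symm hp2),
    hasGoodOrdinaryReductionOverQuadraticAt_of_subGordTwo hp2 W hX hS, hX.1⟩

end Summit.BirchSwinnertonDyer.BirchSwinnertonDyer.Theorems.SchneiderFree

end
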